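import Summits.FinalStateConjecture.FinalStateConjecture.Theorems.SeamedChartsExhaust.Negative.ExactSchwarzschildClauses

/-!
# Finite speed of light in Kerr–Schild coordinates; SEAMED (8) is load-bearing for the first-contact stub
# (negative-side support for crux `stmt-FinalStateConjecture-13551`, route `StarvedNecks`; cycle 2, part 5)

* `KerrTime.spatialNorm_le_abs_of_isCausal`: on every Kerr–Schild patch with `M ≥ 0` the light cones of
  `g = η + 2H ℓ ⊗ ℓ` (`H ≥ 0`) lie inside the Minkowski cones, `‖v̲‖ ≤ |v⁰|` for causal `v`;
  `KerrTime.exists_norm_spatial_sub_le_of_mem_causalPast`: hence `p ∈ J⁻(S)` forces some `q ∈ S` with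
  `‖q̲ − p̲‖ ≤ q⁰ − p⁰` (coordinate speed of light `≤ 1`), via the monotone functionals
  `s ↦ −x⁰ + ⟨e, x̲⟩`, `‖e‖ ≤ 1`, along past-directed causal curves (`monotoneOn_neg_time_add_inner`).
* `not_firstContact_without_seamed8`: the landed first-contact theorem of the crux's picked line
  (`Theorems/StarvedNecksSeamedChartsExhaustStubFirstContact.lean`, hypotheses `hd`, `hR`, `h8`) is FALSE
  without `h8` = SEAMED (8): in the exact Schwarzschild model (`ExactSchwarzschildModel.lean`; mass `1`,
  exterior patch, `R₀ = 100`) with radii `R ≡ 0`, `τ₁ = 1/16` and the flat-late point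
  `y = (1/64, ρ(1/64) + 1/16, 0, 0)`, the right disjunct needs `r(c) ≤ 0` on the flat domain and the left
  one is excluded by finite speed of light, because the flat tube `ρ(t) = R₀ + 1 + √t` outruns light near
  `t = 0` — precisely what (8) forbids. (Formalises the paper witness of the drefute g3 seat.)

References: M. Dafermos, I. Rodnianski, *Lectures on black holes and linear waves*, arXiv:0811.0354, §5.1;
B. O'Neill, *Semi-Riemannian geometry*, Academic Press 1983, Ch. 3, p. 55 and Ch. 14, pp. 402–403.
-/

noncomputable section

open TopologicalSpace Manifold Filter Topology Set Function
open scoped ContDiff Topology ENNReal Manifold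

-- instance search through nested operator types `E4 →L E4 →L E4 →L ℝ` (as in the tree files)
set_option maxSynthPendingDepth 3

namespace Summit.FinalStateConjecture.FinalStateConjecture.Theorems.SeamedChartsExhaust.Negative

open Literature.Geometry.Lorentzian LorentzianMetric

/-! ## Kerr–Schild light cones lie inside the Minkowski cones (`M ≥ 0`) -/

namespace KerrTime

-- `Kerr.spacetime` takes the instance hypothesis `[Kerr.Facts]`; the generic lemmas keep it as a hypothesis,
-- the model namespace `SchwModel` instantiates it (`SchwModel.kerrFacts`, scoped).
variable [Kerr.Facts] {M a r₀ : ℝ} {hM : 0 ≤ M}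

omit [Kerr.Facts] in
/-- `η(v, v) = −(v⁰)² + ‖v̲‖²`. O'Neill 1983, Ch. 3, p. 55. [folklore] -/
theorem minkowski_bilin_self (v : E4) : Minkowski.bilin v v = -(v 0) ^ 2 + E4.spatialNorm v ^ 2 := by
  rw [Minkowski.bilin_apply, E4.spatialNorm_sq, Fin.sum_univ_three]
  simp only [Fin.succ_zero_eq_one, Fin.succ_one_eq_two]
  have h3 : (2 : Fin 3).succ = (3 : Fin 4) := rfl
  rw [h3]
  ring

set_option backward.isDefEq.respectTransparency false in
/-- Chain rule for a continuous linear functional `L` along a differentiable curve in the Kerr–Schild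
patch: `L ∘ γ` has derivative `L(γ')`. [folklore] -/
theorem hasDerivAt_clm_comp (L : E4 →L[ℝ] ℝ) {γ : ℝ → (Kerr.spacetime M a r₀ hM).carrier} {s : ℝ}
    (hγ : MDifferentiableAt 𝓘(ℝ, ℝ) (𝓡 4) γ s) :
    HasDerivAt (fun s ↦ L (γ s).1) (L (show E4 from velocity (𝓡 4) γ s)) s := by
  have hφ : HasMFDerivAt (𝓡 4) 𝓘(ℝ, ℝ)
      (fun x : (Kerr.spacetime M a r₀ hM).carrier ↦ L x.1) (γ s)
      (L.comp (ContinuousLinearMap.id ℝ E4)) :=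
    L.hasMFDerivAt.comp (γ s) (hasMFDerivAt_subtypeVal (I' := 𝓡 4) (γ s))
  rw [hasDerivAt_iff_hasFDerivAt, ← hasMFDerivAt_iff_hasFDerivAt]
  apply (hφ.comp s hγ.hasMFDerivAt).congr_mfderiv
  rw [ContinuousLinearMap.ext_iff]
  intro (r : ℝ)
  have hr : (mfderiv 𝓘(ℝ, ℝ) (𝓡 4) γ s) r = r • (mfderiv 𝓘(ℝ, ℝ) (𝓡 4) γ s) (1 : ℝ) := by
    rw [← map_smul]
    congr 1
    exact (mul_one r).symm
  change L ((mfderiv 𝓘(ℝ, ℝ) (𝓡 4) γ s) r) = r • L (show E4 from velocity (𝓡 4) γ s)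
  rw [hr, map_smul, smul_eq_mul, smul_eq_mul]
  rfl

/-- **Kerr–Schild cones lie inside the Minkowski cones** (`M ≥ 0`): a `g`-causal vector is `η`-causal,
`‖v̲‖ ≤ |v⁰|`, since `g(v, v) = η(v, v) + 2H ℓ(v)²` with `H ≥ 0`. Dafermos–Rodnianski arXiv:0811.0354,
§5.1. [folklore] -/
theorem spatialNorm_le_abs_of_isCausal {x : (Kerr.spacetime M a r₀ hM).carrier} {v : E4}
    (hv : (Kerr.spacetime M a r₀ hM).metric.IsCausal (x := x) v) : E4.spatialNorm v ≤ |v 0| := by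
  have hc : Kerr.bilin M a x.1 v v ≤ 0 := hv.1
  rw [Kerr.bilin_apply, minkowski_bilin_self] at hc
  have hH := Kerr.scalarH_nonneg hM a x.1
  have hl : 0 ≤ Kerr.nullCovector a x.1 v * Kerr.nullCovector a x.1 v := mul_self_nonneg _
  have hsq : E4.spatialNorm v ^ 2 ≤ |v 0| ^ 2 := by rw [sq_abs]; nlinarith
  have h1 := Real.sqrt_le_sqrt hsq
  rwa [Real.sqrt_sq (E4.spatialNorm_nonneg v), Real.sqrt_sq (abs_nonneg _)] at h1

/-- Along a future causal curve of the REVERSED orientation (i.e. a past-directed causal curve), for every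
`e ∈ E3` with `‖e‖ ≤ 1` the function `s ↦ −x⁰(γ s) + ⟨e, x̲(γ s)⟩` is monotone: its derivative is
`−v⁰ + ⟨e, v̲⟩ ≥ −v⁰ − ‖v̲‖ ≥ 0` (cones inside Minkowski cones, `v⁰ < 0`). [folklore] -/
theorem monotoneOn_neg_time_add_inner {γ : ℝ → (Kerr.spacetime M a r₀ hM).carrier} {s₁ s₂ : ℝ}
    (hγ : (Kerr.spacetime M a r₀ hM).metric.IsFutureCausalCurveOn
      (Kerr.spacetime M a r₀ hM).timeOrientation.reverse γ (Icc s₁ s₂)) (e : E3) (he : ‖e‖ ≤ 1) :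
    MonotoneOn (fun s ↦ -(γ s).1 0 + inner ℝ e (E4.spatial (γ s).1)) (Icc s₁ s₂) := by
  set L : E4 →L[ℝ] ℝ := -EuclideanSpace.proj (0 : Fin 4) + (innerSL ℝ e).comp E4.spatial with hL
  have hLv : ∀ v : E4, L v = -v 0 + inner ℝ e (E4.spatial v) := fun v ↦ by simp [hL]
  have hcont : ContinuousOn (fun s ↦ L (γ s).1) (Icc s₁ s₂) := fun s hs ↦
    ((L.continuous.comp continuous_subtype_val).continuousAt.comp (hγ.continuousAt hs)).continuousWithinAt
  have key : MonotoneOn (fun s ↦ L (γ s).1) (Icc s₁ s₂) := by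
    refine monotoneOn_of_hasDerivWithinAt_nonneg (convex_Icc s₁ s₂) hcont
      (fun s hs ↦ (hasDerivAt_clm_comp L (hγ s (interior_subset hs)).1).hasDerivWithinAt) fun s hs ↦ ?_
    have hfd := (hγ s (interior_subset hs)).2
    set v : E4 := (show E4 from velocity (𝓡 4) γ s) with hv
    have h0 : v 0 < 0 := velocity_zero_neg hfd
    have hsp : E4.spatialNorm v ≤ |v 0| := by
      rw [TimeOrientation.isFutureDirected_reverse_iff] at hfd
      exact spatialNorm_le_abs_of_isCausal hfd.1
    rw [abs_of_neg h0] at hsp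
    have hin : |inner ℝ e (E4.spatial v)| ≤ E4.spatialNorm v := by
      refine (abs_real_inner_le_norm e _).trans ?_
      rw [E4.spatialNorm]
      exact mul_le_of_le_one_left (norm_nonneg _) he
    show (0 : ℝ) ≤ L v
    rw [hLv]
    linarith [neg_abs_le (inner ℝ e (E4.spatial v))]
  simpa only [hLv] using key

/-- **Finite speed of light in Kerr–Schild coordinates** (`M ≥ 0`): if `p ∈ J⁻(S)` then some `q ∈ S`
has `‖q̲ − p̲‖ ≤ q⁰ − p⁰`. Dafermos–Rodnianski arXiv:0811.0354, §5.1. [folklore] -/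
theorem exists_norm_spatial_sub_le_of_mem_causalPast {S : Set (Kerr.spacetime M a r₀ hM).carrier}
    {p : (Kerr.spacetime M a r₀ hM).carrier}
    (hp : p ∈ (Kerr.spacetime M a r₀ hM).metric.causalPast
      (Kerr.spacetime M a r₀ hM).timeOrientation S) :
    ∃ q ∈ S, ‖E4.spatial q.1 - E4.spatial p.1‖ ≤ q.1 0 - p.1 0 := by
  rcases hp with hp | ⟨q, hq, γ, s₁, s₂, hs, hγ, hγ₁, hγ₂⟩
  · exact ⟨p, hp, by simp⟩
  · refine ⟨q, hq, ?_⟩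
    -- for every `e` of norm ≤ 1: ⟨e, q̲ − p̲⟩ ≤ q⁰ − p⁰
    have hine : ∀ e : E3, ‖e‖ ≤ 1 → inner ℝ e (E4.spatial q.1 - E4.spatial p.1) ≤ q.1 0 - p.1 0 := by
      intro e he
      have hmono := monotoneOn_neg_time_add_inner hγ e he ⟨le_rfl, hs.le⟩ ⟨hs.le, le_rfl⟩ hs.le
      simp only at hmono
      rw [hγ₁, hγ₂] at hmono
      rw [inner_sub_right]
      linarith
    set w : E3 := E4.spatial q.1 - E4.spatial p.1 with hw
    by_cases hw0 : w = 0
    · have h := hine 0 (by simp)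
      rw [hw0, norm_zero]
      simpa using h
    · have hn : 0 < ‖w‖ := norm_pos_iff.mpr hw0
      have he : ‖‖w‖⁻¹ • w‖ ≤ 1 := by
        rw [norm_smul, norm_inv, norm_norm, inv_mul_cancel₀ hn.ne']
      have h := hine _ he
      rwa [real_inner_smul_left, real_inner_self_eq_norm_sq, pow_two, ← mul_assoc,
        inv_mul_cancel₀ hn.ne', one_mul] at h

end KerrTime

namespace SchwModel

/-- Concrete parameters: mass `1`, the exterior patch `{r > 2}`, `R₀ = 100`. -/
def P₁ : Params := ⟨1, 2, 100, one_pos, two_pos, by norm_num, by norm_num⟩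

/-- The flat-late point `y = (1/64, ρ(1/64) + 1/16, 0, 0)` just outside the flat tube at an early time. -/
def yE (P : Params) : E4 := E4.ofTimeSpace (1 / 64) ((ρ P (1 / 64) + 1 / 16) • EuclideanSpace.single (0 : Fin 3) (1 : ℝ))

variable (P : Params)

/-- `y⁰ = 1/64`. [folklore] -/
theorem yE_zero : yE P 0 = 1 / 64 := E4.ofTimeSpace_apply_zero _ _

/-- `ρ > 0`. [folklore] -/
theorem ρ_pos (t : ℝ) : 0 < ρ P t := by linarith [ρ_ge P t, P.R₀_pos]

/-- `‖y̲‖ = ρ(1/64) + 1/16`. [folklore] -/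
theorem spatialNorm_yE : E4.spatialNorm (yE P) = ρ P (1 / 64) + 1 / 16 := by
  rw [yE, E4.spatialNorm_ofTimeSpace, norm_smul, Real.norm_eq_abs, abs_of_pos (by linarith [ρ_pos P (1/64)])]
  simp

/-- `y` lies in the flat domain. [folklore] -/
theorem yE_mem_U : yE P ∈ U P := by
  refine ⟨by rw [yE_zero]; norm_num, ?_⟩
  rw [Kerr.radius_zero_left, spatialNorm_yE, yE_zero]
  linarith

/-- `ρ(1/16) − ρ(1/64) = 1/4 − 1/8 = 1/8`: the flat tube grows faster than light near `t = 0`. -/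
theorem ρ_gap : ρ P (1 / 16) - ρ P (1 / 64) = 1 / 8 := by
  have h1 : √(1 / 16 : ℝ) = 1 / 4 := by
    rw [show (1 / 16 : ℝ) = (1 / 4) ^ 2 by norm_num, Real.sqrt_sq (by norm_num)]
  have h2 : √(1 / 64 : ℝ) = 1 / 8 := by
    rw [show (1 / 64 : ℝ) = (1 / 8) ^ 2 by norm_num, Real.sqrt_sq (by norm_num)]
  simp only [ρ, h1, h2]
  ring

/-- In the model, the flat-late point `Φ(y)` is NOT causally below the flat slab at chart time `1/16`:
a slab point has `‖x̲‖ > ρ(1/16) = ρ(1/64) + 1/8`, but light from `y` (`x⁰ = 1/64`, `‖y̲‖ = ρ(1/64) + 1/16`)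
gains at most `1/16 − 1/64` in radius by then (finite speed of light in Kerr–Schild coordinates). -/
theorem Φ_yE_not_mem_causalPast_flatSlab :
    Φ P ⟨yE P, yE_mem_U P⟩ ∉ (ST P).metric.causalPast (ST P).timeOrientation
      (Φ P '' (Minkowski.backgroundOn (U P)).timeSlab (1 / 16)) := by
  intro h
  obtain ⟨q, ⟨z, hz, rfl⟩, hle⟩ := KerrTime.exists_norm_spatial_sub_le_of_mem_causalPast h
  have hz0 : z.1 0 = 1 / 16 := hz
  have hzr : ρ P (1 / 16) < E4.spatialNorm z.1 := by
    have := z.2.2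
    rwa [Kerr.radius_zero_left, hz0] at this
  rw [Φ_val, Φ_val, hz0, yE_zero] at hle
  have htri : E4.spatialNorm z.1 - E4.spatialNorm (yE P) ≤ ‖E4.spatial z.1 - E4.spatial (yE P)‖ := by
    rw [E4.spatialNorm, E4.spatialNorm]
    exact (norm_sub_norm_le _ _)
  rw [spatialNorm_yE] at htri
  linarith [ρ_gap P]

end SchwModel

open scoped SchwModel in
/-- **SEAMED (8) is load-bearing for the first-contact stub.** The landed theorem `stub_firstContact`
of crux `stmt-FinalStateConjecture-13551` (line `wide-anchoring`; hypotheses `hd` = `HonestCore` (d),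
`hR` = continuity of the radii, `h8` = SEAMED (8)) becomes FALSE when `h8` is deleted: in the exact
Schwarzschild model (mass `1`, exterior patch, `R₀ = 100`; `hd` holds by `honestCore_decomp`) take the
radii `R ≡ 0` (continuous) , `τ₁ = 1/16` and the flat-late point `y = (1/64, ρ(1/64) + 1/16, 0, 0)`:
the RIGHT disjunct needs a flat-domain point `c` with `r(c) ≤ 0`, impossible (`r > ρ > 0` on the flat
domain), and the LEFT disjunct fails by finite speed of light (`Φ_yE_not_mem_causalPast_flatSlab`: the flat
tube `ρ(t) = R₀ + 1 + √t` outruns light near `t = 0`, which is exactly what (8) — "flat tubes lie deep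
inside certified tubes" — rules out). Formalises the paper witness of drefute g3 (`DrefuteG3.md`).
Dafermos–Rodnianski arXiv:0811.0354, §5.1. [folklore] -/
theorem not_firstContact_without_seamed8 :
    ¬ ∀ (𝓢 : Spacetime.{0} 4) (O : Set 𝓢.carrier) (d : FinalStateDecomposition 𝓢 O 2)
        (R : Fin d.N → ℝ → ℝ),
      (∀ y : d.flatDomain, d.τ₀ < y.1 0 →
        𝓢.timeOrientation.IsFutureDirected
          (mfderiv 𝓘(ℝ, E4) (𝓡 4) d.flatChart y (E4.basisVector 0))) →
      (∀ i, Continuous (R i)) →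
      ∀ (τ₁ : ℝ) (y : d.flatDomain), d.τ₀ < y.1 0 → y.1 0 ≤ τ₁ →
        d.flatChart y ∈ 𝓢.metric.causalPast 𝓢.timeOrientation
            (d.flatChart '' (Minkowski.backgroundOn d.flatDomain).timeSlab τ₁) ∨
          ∃ (c : d.flatDomain) (k : Fin d.N), d.τ₀ < c.1 0 ∧ c.1 0 ≤ τ₁ ∧
            (d.background k).radius c.1 ≤ R k ((d.background k).time c.1) ∧
            d.flatChart y ∈ 𝓢.metric.causalPast 𝓢.timeOrientation {d.flatChart c} := by
  intro h
  set P := SchwModel.P₁ with hP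
  have hd := (SchwModel.honestCore_decomp P).2.2.2
  rcases h (SchwModel.ST P) (SchwModel.O P) (SchwModel.decomp P) (fun _ _ ↦ 0) hd
      (fun _ ↦ continuous_const) (1 / 16) ⟨SchwModel.yE P, SchwModel.yE_mem_U P⟩
      (by show (0 : ℝ) < SchwModel.yE P 0; rw [SchwModel.yE_zero]; norm_num)
      (by show SchwModel.yE P 0 ≤ 1 / 16; rw [SchwModel.yE_zero]; norm_num) with hL | ⟨c, k, -, -, hcr, -⟩
  · exact SchwModel.Φ_yE_not_mem_causalPast_flatSlab P hL
  · have hc := c.2.2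
    rw [SchwModel.decomp_background, SchwModel.bg_radius] at hcr
    linarith [SchwModel.ρ_pos P (c.1 0)]

end Summit.FinalStateConjecture.FinalStateConjecture.Theorems.SeamedChartsExhaust.Negative

end
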